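/-
COR-CM INTERFACES (cell pub-hodgecm2 = stage 2 of the Hodge ladder; lead/typer planner-pub-hodgecm2-lead-0, 2026-08-20).
Everything in this file is either (a) a NAME for an existing tree declaration, (b) a verbatim port of the pub-hodgecm
package's model universe (`HodgeCM/Model/Universe.lean`, md5 d9c7e6a8625f08efda5dbd895b580144, ll. 70–143 and 225–236:
`cmEmb … picardCMUniverse`, rules R1–R5 of `CMBasic.lean`), (c) the stage-2 TARGET propositions, or (d) KERNEL wiring
already available in the tree (the dictionary arrow A3 of `HOME/CHAIN-MAP.md`).  Nothing is asserted.
-/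
import Summits.HodgeConjecture.CorCM.Model.Universe
import Summits.HodgeConjecture.HodgeConjecture.Theses.RankFourFaces
import Literature.NumberTheory.Automorphic.PicardCMEigenbasis
import Literature.AlgebraicGeometry.HodgeTheory.AbelianVarietyHodgeFullnessRecord
import HarnessLib

/-!
# COR-CM — interfaces of stage 2 (`HC_CM` from the period theorem in FACE FORM)

TWO INTERFACES (both BY NAME, neither restated):

* **Target** `HC_CM` := `Summit.HodgeConjecture.HodgeConjecture.Theses.RankFourFaces.CMAbelianHodge`
  (`Summits/HodgeConjecture/HodgeConjecture/Theses/RankFourFaces.lean` l.339, item `stmt-HodgeConjecture-3052`; the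
  hypothesis pub-hodge-ring2 consumes in `Theorems/Ring2Hypotheses.lean` ll.105/201/216).
* **Hypothesis** = stage 1's conclusion SHAPE `Universe.PerL` (`CorCM/Geometry/Statements.lean`, the verbatim port of the
  pub-hodgecm package file `HodgeCM/Geometry/Statements.lean`, md5 d7478b5ec7df13c6dede103cbdeb18cd, `def PerL` ll.48–57
  there), instantiated at THE model universe `Model.picardCMUniverse hHD hI h₁ h₃` below (verbatim port of the package's
  `HodgeCM.Model.picardCMUniverse`, `HodgeCM/Model/Universe.lean` md5 d9c7e6a8625f08efda5dbd895b580144 l.232) — the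
  universe on which the stage-1 E term of record `HodgeCM.Model.perL_picardCM_r21AEOGI`
  (`HodgeCM/Model/E2InstanceOGR21AEPI.lean` md5 95e6432065d923ce87004dd4e28aa807, l.34, conclusion l.84
  `(picardCMUniverse hHD hI h₁ (cmAbelianVarietyRealised_of_eigenbasis hHD hI h₃)).PerL`) concludes.

TYPING FINDING (gap G-T of `HOME/CHAIN-MAP.md`, flagged to the director and to pub-hodgecm): the COR-CM chain of the
2001 texts ([QW8] Thm 0.3 (i) = `Universe.hc_cm_of` of the package, `HodgeCM/Assembly/CorCM.lean` l.114) consumes the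
period theorem in FACE FORM `Universe.PeriodThmF` (rfwf §4.2 transposed form: every Galois CM field `F` with
`6 ≤ [F:ℚ]`, every admissible rank-four face) — NOT the sextic statement `Universe.PerL` (`[K:ℚ] = 6`,
`[L:ℚ] ∈ {24, 48}`).  `U.PerL → U.PeriodThmF` is NOT a formal consequence (the face form quantifies over CM fields of
every even degree `≥ 6`; `PerL` only produces hermitian spaces over the Galois closure of a sextic field), and the
package proves no such implication.  Accordingly this file records TWO targets over the same model universe: the LITERAL one `HC_CM_of_PerL`
(hypothesis `U.PerL` verbatim — the coordinator's interface of record) and the WORKING one `HC_CM_of_PerLFace`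
(hypothesis `PerLFace := Universe.PeriodThmF`, verbatim from the same pinned file, `def PeriodThmF` ll.69–73 of the
package file) — the only shape the 2001 chain can consume; `hc_cm_of_PerL_of_face` derives the literal target from the
working one and the residual implication `PerLFace_of_PerL` (binder B01 of `HOME/BINDER-OWNERS.md`, an OPEN statement,
not a formal consequence: it amounts to re-running stage 1's method in the face setting, package input
`Universe.RealisationExistsFace` + `StubTree.PerLProof.periodThmF_holds`).

KERNEL ARROW A3 (dictionary, this file): `(Model.picardCMUniverse hHD hI h₁ h₃).HC_CM` is BY `Iff.rfl` the tree's
`Literature.AlgebraicGeometry.Milne1999.CodesHC hHD (ballQuotientUniformisedDatum_of h₁) h₃`, and the tree theorem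
`Milne1999.forall_cmHodgeHypothesisAt_of_codesHC_of_riemann` (isogeny-category structure theorem of CM abelian
varieties + isogeny invariance of the Hodge conjecture, over the cited record `DeligneMilne1982_Thm_6_20_full` that
stage 1 already carries as binder `hR`) turns it into `HC_CM` — wired in the sibling file `CorCM/DictionaryA3.lean`
(`hc_cm_of_model_hc_cm`, `hc_cm_of_PerL_of_modelChain`; kept apart so that this interface file imports nothing of the
tree's `Milne1999/TateFromCodesHC*` chain).  Hence the stage-2 E term reduces to the package's `U`-level chain A1 + A2
(`Universe.hc_cm_of ∘ Universe.w_rk4_of`, to be ported under `Summits/HodgeConjecture/CorCM/`) instantiated at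
`U := Model.picardCMUniverse …`.
-/

noncomputable section

open scoped TensorProduct Matrix ComplexOrder
open NumberField
open Literature.AlgebraicGeometry.Motives (CMType)
open Literature.AlgebraicGeometry.Motives
open Literature.AlgebraicGeometry.Motives.HodgeStructure (EndAction conj ofRat)
open Literature.AlgebraicGeometry.ShimuraVarieties

namespace Summit.HodgeConjecture.CorCM

/-! ## The target, by name -/

/-- **`HC_CM`** — the Hodge conjecture for abelian varieties of CM type, BY NAME: the RankFourFaces route item
`CMAbelianHodge` (= `∀ A : AbelianVariety ℂ, IsSmoothProjective A.dim A.X → IsOfCMType-shape → HodgeConjectureFor A.dim A.X`).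
Never restated in this cell. [folklore] -/
abbrev HC_CM : Prop := Summit.HodgeConjecture.HodgeConjecture.Theses.RankFourFaces.CMAbelianHodge

/-- `HC_CM` is, definitionally, Milne's `∀ A, CMHodgeHypothesisAt A` of the tree (junction used by arrow A3). -/
theorem hc_cm_iff_forall_cmHodgeHypothesisAt :
    HC_CM ↔ ∀ A : AbelianVariety ℂ, Literature.AlgebraicGeometry.Milne1999.CMHodgeHypothesisAt A :=
  Iff.rfl

/-! ## Stage-2 interface propositions -/

open Literature.NumberTheory.Automorphic.PicardCM
open Literature.AlgebraicGeometry.HodgeTheory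

/-- **`PerLFace`** — the period theorem in FACE FORM, BY NAME: `Universe.PeriodThmF` (rfwf §4.2 transposed; verbatim
port, `CorCM/Geometry/Statements.lean`).  This — not the sextic `Universe.PerL` — is the hypothesis the COR-CM chain
consumes (module docstring, TYPING FINDING). [folklore] -/
abbrev Universe.PerLFace (U : Universe) : Prop := U.PeriodThmF

/-- **Working stage-2 target `HC_CM_of_PerLFace`** (hypothesis in FACE FORM, see the TYPING FINDING of the module
docstring): for every instance of the model universe — the tree theorems `hHD`, `hI` and the two cited realisation records
`h₁`, `h₃` of stage 1 — the face-form period theorem ON THAT UNIVERSE, together with stage 1's cited record `hR`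
(Deligne–Milne 1982, Thm 6.20, full form), implies the Hodge conjecture for CM abelian varieties `HC_CM`.
The E term of stage 2 is a proof of this proposition; its binders of record are listed in `HOME/BINDER-OWNERS.md`. -/
@[conjecture]
def HC_CM_of_PerLFace : Prop :=
  ∀ (hHD : exists_isReal_hodgeModel) (hI : hodgePQ_independent_of_hodgeModel)
    (h₁ : BallQuotientUniformised) (h₃ : CMAbelianVarietyRealised),
    (Model.picardCMUniverse hHD hI h₁ h₃).PerLFace → DeligneMilne1982_Thm_6_20_full → HC_CM

/-- **Literal stage-2 target `HC_CM_of_PerL`** — hypothesis = stage 1's conclusion `U.PerL` VERBATIM (sextic form,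
`CorCM/Geometry/Statements.lean` `def PerL`, block md5 3de21ce86ba1e84c0aa43f06cd728ee6 of the referee's pin) on the model
universe: the coordinator's interface of record.  It follows from the working target `HC_CM_of_PerLFace` and binder B01
`PerLFace_of_PerL` (`hc_cm_of_PerL_of_face`); the 2001 chain does not prove it directly (gap G-T). -/
@[conjecture]
def HC_CM_of_PerL : Prop :=
  ∀ (hHD : exists_isReal_hodgeModel) (hI : hodgePQ_independent_of_hodgeModel)
    (h₁ : BallQuotientUniformised) (h₃ : CMAbelianVarietyRealised),
    (Model.picardCMUniverse hHD hI h₁ h₃).PerL → DeligneMilne1982_Thm_6_20_full → HC_CM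

/-- **Binder B01 (gap G-T) as a proposition**: on the model universe the sextic period theorem implies its face form. -/
@[conjecture]
def PerLFace_of_PerL : Prop :=
  ∀ (hHD : exists_isReal_hodgeModel) (hI : hodgePQ_independent_of_hodgeModel)
    (h₁ : BallQuotientUniformised) (h₃ : CMAbelianVarietyRealised),
    (Model.picardCMUniverse hHD hI h₁ h₃).PerL → (Model.picardCMUniverse hHD hI h₁ h₃).PerLFace

/-- Wiring: the working target and binder B01 give the literal-shape target. -/
theorem hc_cm_of_PerL_of_face (h : HC_CM_of_PerLFace) (hB01 : PerLFace_of_PerL) : HC_CM_of_PerL :=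
  fun hHD hI h₁ h₃ hP hR => h hHD hI h₁ h₃ (hB01 hHD hI h₁ h₃ hP) hR

/-- Junction at the model universe: `(picardCMUniverse …).HC_CM ↔ Milne1999.CodesHC …` (definitional). -/
theorem picardCMUniverse_hc_cm_iff_codesHC (hHD : exists_isReal_hodgeModel)
    (hI : hodgePQ_independent_of_hodgeModel) (h₁ : BallQuotientUniformised) (h₃ : CMAbelianVarietyRealised) :
    (Model.picardCMUniverse hHD hI h₁ h₃).HC_CM ↔
      Literature.AlgebraicGeometry.Milne1999.CodesHC hHD (ballQuotientUniformisedDatum_of h₁) h₃ :=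
  Model.universeOf_hc_cm_iff_codesHC


/-- The stage-1 E term's universe is an instance of the interface universe: for the eigenbasis record
`h₃ : CMAbelianVarietyEigenbasisRealised` of `perL_picardCM_r21AEOGI`, the universe
`picardCMUniverse hHD hI h₁ (cmAbelianVarietyRealised_of_eigenbasis hHD hI h₃)` is `Model.picardCMUniverse` at the
derived record (definitional; recorded so that the countersign compares like with like). -/
theorem stage1_universe_is_instance (hHD : exists_isReal_hodgeModel) (hI : hodgePQ_independent_of_hodgeModel)
    (h₁ : BallQuotientUniformised) (h₃ : CMAbelianVarietyEigenbasisRealised) :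
    Model.picardCMUniverse hHD hI h₁ (cmAbelianVarietyRealised_of_eigenbasis hHD hI h₃) =
      Model.universeOf hHD hI (ballQuotientUniformisedDatum_of h₁)
        (cmAbelianVarietyRealised_of_eigenbasis hHD hI h₃) :=
  rfl

end Summit.HodgeConjecture.CorCM
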